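import Summits.ResolutionOfSingularities.ResolutionOfSingularities.Theorems.PurelyInseparableDim4PureLeafGlobalWinTheorem
import Summits.ResolutionOfSingularities.ResolutionOfSingularities.Theorems.PurelyInseparableDim4FlatAbsorbPrep
import HarnessLib
import HarnessLib.Audit.Tags

/-!
# Purely inseparable fourfolds — a `q`-th-POWER SUMMAND THAT LOWERS NO `ord_S` IS INVISIBLE TO THE GAME;
# unit leaves `x^a·(1+x_j)` with `a_j` ODD and all other exponents EVEN win over `𝔽₂`
# (cell res-dim4-pi; brick (δ) «product class 𝓤», FILE 2) [OURS · counted 0 · about OUR frame, not about resolution]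

Width seat `res-dim4-p-10` (g4).  Step 1 of the brick («cleaning is invisible to the next step») is the tree's
`MohAlong.deletePthPowers_translate_chartTransform_deletePthPowers` (p-1, p647102).  This file draws the
game-theoretic consequence, for every field `K` of characteristic `p` and `q = pⁿ`:

* **`PthPowerShift.step_add_eq`**, **`isEquimultiplePoint_add_iff`**, **`edge_add_iff`** — if every monomial of
  `T` is a `q`-th-power exponent and `ord_S(F + T) = ord_S F` for every coordinate centre `S`, then the states
  `⟨F + T, r, exc⟩` and `⟨F, r, exc⟩` have the SAME permissible centres, the SAME equimultiple points and the SAME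
  successor under every `CentreBlowup.step` (the chart law keeps `q`-th-power exponents, the translation keeps
  `q`-th powers by Frobenius, the cleaning deletes them; the new multiplicities read `ord_S`);
* **`PthPowerShift.stateWins_add_iff`** — hence `StateWins q ⟨F + T, r, exc⟩ ↔ StateWins q ⟨F, r, exc⟩`
  (`wins_congr`: A's attractor only sees legal moves and answers);
* **`PureLeafNF.stateWins_unitLeaf_odd_of_forall_even`** — over `𝔽₂`, `q = 2`: a unit leaf `x^a·(1+x_j)` with
  `a_j` ODD and `a_k` EVEN for `k ≠ j` is `x^a + (square monomial dominating x^a)`, so it is an A-win of the plain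
  global game, every booking, by D3b's `PureLeafNF.stateWins_monomial` (p684251).  With FILE 1
  (`…PureLeafUnitEven`, p702830: `a_j` even) the unit leaves NOT covered by a uniform theorem are exactly those with
  `a_j` odd and another odd exponent.

Riders: `𝔽₂`-rational replies for the corollary; plain game, not MODE 1h; NOT F4-C(2,2).  Nothing here proves
resolution of singularities in dimension ≥ 4 / characteristic `p`; counted 0; AI work, weaker than expert review.
bears_on: LADDER-RESOLUTION:D157-DOOR2 (res-dim4-pi · brick (δ) FILE 2 · CONFIGS unit-leaf row). Supports
stmt-ResolutionOfSingularities-16155 (helper).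
-/

set_option linter.dupNamespace false

open MvPolynomial Finset

open scoped BigOperators

noncomputable section

namespace Summit.ResolutionOfSingularities.ResolutionOfSingularities.Theorems.PIDim4

open Literature.AlgebraicGeometry.Resolution
open Literature.AlgebraicGeometry.Resolution.Hauser2010
open CentreBlowup

/-! ## 1. A's attractor is determined by the legal moves and their answers -/

namespace PthPowerShift

/-- Two positions with the same legal moves and the same answers are won together. [folklore] -/
theorem wins_congr {P M : Type} {legal : P → M → Prop} {succ : P → M → P → Prop} {x x' : P}
    (hl : ∀ m, legal x m ↔ legal x' m) (hs : ∀ m y, succ x m y ↔ succ x' m y)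
    (h : Game.Wins legal succ x) : Game.Wins legal succ x' := by
  cases h with
  | terminal h0 => exact Game.Wins.terminal fun m hm => h0 m ((hl m).mpr hm)
  | move hm h1 => exact Game.Wins.move ((hl _).mp hm) fun y hy => h1 y ((hs _ _).mpr hy)

/-! ## 2. A `q`-th-power summand is invisible to the step -/

variable {K : Type} [Field K] [DecidableEq K] (p : ℕ) [hp : Fact p.Prime] [CharP K p]

omit [DecidableEq K] hp [CharP K p] in
/-- A polynomial all of whose monomials are `q`-th-power exponents is deleted entirely by the cleaning. [folklore] -/
theorem deletePthPowers_eq_zero_of_forall (q : ℕ) (T : MvPolynomial (Fin 4) K)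
    (hT : ∀ d ∈ T.support, IsPthPowerExponent q d) : deletePthPowers q T = 0 := by
  unfold deletePthPowers
  refine Finset.sum_eq_zero fun d hd => ?_
  rw [Finset.mem_filter] at hd
  exact absurd (hT d hd.1) hd.2

omit [DecidableEq K] in
/-- The cleaned transform of such a `T` vanishes (chart law, Frobenius, cleaning). [folklore] -/
theorem deletePthPowers_translate_chartTransform_eq_zero (n : ℕ) (S : Finset (Fin 4)) (j : Fin 4)
    (b : Fin 4 → K) (T : MvPolynomial (Fin 4) K) (hT : ∀ d ∈ T.support, IsPthPowerExponent (p ^ n) d) :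
    deletePthPowers (p ^ n) (PointBlowup.translate b (chartTransform (p ^ n) S j T)) = 0 := by
  have h := MohAlong.deletePthPowers_translate_chartTransform_deletePthPowers p n S j b T
  rw [deletePthPowers_eq_zero_of_forall _ T hT, chartTransform_zero] at h
  rw [← h]
  unfold PointBlowup.translate
  rw [map_zero, deletePthPowers_zero]

omit [DecidableEq K] in
/-- **Same equimultiple points** for `⟨F + T, r, exc⟩` and `⟨F, r, exc⟩`. [folklore] -/
theorem isEquimultiplePoint_add_iff (n : ℕ) (S : Finset (Fin 4)) (j : Fin 4) (b : Fin 4 → K)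
    (F T : MvPolynomial (Fin 4) K) (hT : ∀ d ∈ T.support, IsPthPowerExponent (p ^ n) d)
    (r : Fin 4 →₀ ℕ) (exc : Finset (Fin 4)) :
    IsEquimultiplePoint (p ^ n) S j b (⟨F + T, r, exc⟩ : State K) ↔
      IsEquimultiplePoint (p ^ n) S j b (⟨F, r, exc⟩ : State K) := by
  have hz : ∀ d : Fin 4 →₀ ℕ, d ≠ 0 → d.degree < p ^ n →
      coeff d (PointBlowup.translate b (chartTransform (p ^ n) S j T)) = 0 := fun d hd0 hdq =>
    FlatAbsorb.coeff_eq_zero_of_killed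
      (deletePthPowers_translate_chartTransform_eq_zero p n S j b T hT) hd0 hdq
  unfold IsEquimultiplePoint pointTransform
  show (∀ d : Fin 4 →₀ ℕ, d ≠ 0 → d.degree < p ^ n →
      coeff d (PointBlowup.translate b (chartTransform (p ^ n) S j (F + T))) = 0) ↔
    (∀ d : Fin 4 →₀ ℕ, d ≠ 0 → d.degree < p ^ n →
      coeff d (PointBlowup.translate b (chartTransform (p ^ n) S j F)) = 0)
  rw [chartTransform_add, MohAlong.translate_add]
  refine ⟨fun h d hd0 hdq => ?_, fun h d hd0 hdq => ?_⟩
  · have := h d hd0 hdq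
    rwa [coeff_add, hz d hd0 hdq, add_zero] at this
  · rw [coeff_add, hz d hd0 hdq, add_zero]; exact h d hd0 hdq

/-- **Same successor**: `step q S j b ⟨F + T, r, exc⟩ = step q S j b ⟨F, r, exc⟩` when moreover
`ord_S (F + T) = ord_S F` (read by the new multiplicity). [folklore] -/
theorem step_add_eq (n : ℕ) (S : Finset (Fin 4)) (j : Fin 4) (b : Fin 4 → K)
    (F T : MvPolynomial (Fin 4) K) (hT : ∀ d ∈ T.support, IsPthPowerExponent (p ^ n) d)
    (hord : ordAlong S (F + T) = ordAlong S F) (r : Fin 4 →₀ ℕ) (exc : Finset (Fin 4)) :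
    step (p ^ n) S j b (⟨F + T, r, exc⟩ : State K) = step (p ^ n) S j b (⟨F, r, exc⟩ : State K) := by
  simp only [step, CState.mk.injEq]
  refine ⟨?_, ?_, rfl⟩
  · unfold pointTransform
    show deletePthPowers (p ^ n) (PointBlowup.translate b (chartTransform (p ^ n) S j (F + T))) =
      deletePthPowers (p ^ n) (PointBlowup.translate b (chartTransform (p ^ n) S j F))
    rw [chartTransform_add, MohAlong.translate_add, Hauser2010.deletePthPowers_add,
      deletePthPowers_translate_chartTransform_eq_zero p n S j b T hT, add_zero]
  · unfold newMult
    show ((r.filter fun i => b i = 0).update j ((ordAlong S (F + T)).toNat - p ^ n)) =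
      (r.filter fun i => b i = 0).update j ((ordAlong S F).toNat - p ^ n)
    rw [hord]

omit [DecidableEq K] hp [CharP K p] in
/-- **Same permissible centres.** [folklore] -/
theorem isPermissibleCentre_add_iff (q : ℕ) (S : Finset (Fin 4)) (F T : MvPolynomial (Fin 4) K)
    (hord : ordAlong S (F + T) = ordAlong S F) :
    IsPermissibleCentre q S (F + T) ↔ IsPermissibleCentre q S F := by
  unfold IsPermissibleCentre
  rw [hord]

/-- **Same edges.** [folklore] -/
theorem edge_add_iff (n : ℕ) (S : Finset (Fin 4)) (F T : MvPolynomial (Fin 4) K)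
    (hT : ∀ d ∈ T.support, IsPthPowerExponent (p ^ n) d) (hord : ordAlong S (F + T) = ordAlong S F)
    (r : Fin 4 →₀ ℕ) (exc : Finset (Fin 4)) (t : State K) :
    Edge (p ^ n) S (⟨F + T, r, exc⟩ : State K) t ↔ Edge (p ^ n) S (⟨F, r, exc⟩ : State K) t := by
  unfold Edge
  simp only [step_add_eq p n S _ _ F T hT hord r exc, isEquimultiplePoint_add_iff p n S _ _ F T hT r exc]

/-! ## 3. Hence the same winner -/

/-- **A `q`-th-POWER SUMMAND THAT LOWERS NO `ord_S` IS INVISIBLE TO THE GAME**: for every field of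
characteristic `p`, `q = pⁿ`, every `F`, every `T` all of whose monomials are `q`-th-power exponents with
`ord_S (F + T) = ord_S F` for all `S`, and every booking,
`StateWins q ⟨F + T, r, exc⟩ ↔ StateWins q ⟨F, r, exc⟩`. [OURS · counted 0] [folklore] -/
theorem stateWins_add_iff (n : ℕ) (F T : MvPolynomial (Fin 4) K)
    (hT : ∀ d ∈ T.support, IsPthPowerExponent (p ^ n) d) (hord : ∀ S, ordAlong S (F + T) = ordAlong S F)
    (r : Fin 4 →₀ ℕ) (exc : Finset (Fin 4)) :
    StateWins (p ^ n) (⟨F + T, r, exc⟩ : State K) ↔ StateWins (p ^ n) (⟨F, r, exc⟩ : State K) := by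
  have hl : ∀ S : Finset (Fin 4), IsPermissibleCentre (p ^ n) S (⟨F + T, r, exc⟩ : State K).F ↔
      IsPermissibleCentre (p ^ n) S (⟨F, r, exc⟩ : State K).F := fun S =>
    isPermissibleCentre_add_iff (p ^ n) S F T (hord S)
  have hs : ∀ (S : Finset (Fin 4)) (t : State K), Edge (p ^ n) S (⟨F + T, r, exc⟩ : State K) t ↔
      Edge (p ^ n) S (⟨F, r, exc⟩ : State K) t := fun S t => edge_add_iff p n S F T hT (hord S) r exc t
  unfold StateWins
  exact ⟨fun h => wins_congr hl hs h, fun h => wins_congr (fun S => (hl S).symm) (fun S t => (hs S t).symm) h⟩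

end PthPowerShift

/-! ## 4. Unit leaves with `a_j` odd and every other exponent even -/

namespace PureLeafNF

/-- **A UNIT LEAF `x^a·(1+x_j)` WITH `a_j` ODD AND ALL OTHER EXPONENTS EVEN WINS THE PLAIN GLOBAL GAME OVER
`𝔽₂`** (`q = 2`, every booking): `x^a·(1+x_j) = x^a + x^{a+δ_j}` with `x^{a+δ_j}` a square dominating `x^a`, so
the game is that of the pure leaf `x^a` (`PthPowerShift.stateWins_add_iff`), won by D3b's `stateWins_monomial`.
[OURS · counted 0] [folklore] -/
theorem stateWins_unitLeaf_odd_of_forall_even (j : Fin 4) (a : Fin 4 → ℕ) (hodd : a j % 2 = 1)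
    (heven : ∀ k, k ≠ j → a k % 2 = 0) (r : Fin 4 →₀ ℕ) (exc : Finset (Fin 4)) :
    StateWins 2 (⟨monomial (Finsupp.equivFunOnFinite.symm a) 1 * (1 + X j), r, exc⟩ : State (ZMod 2)) := by
  rw [mul_add, mul_one, X, monomial_mul, one_mul]
  have hne : Finsupp.equivFunOnFinite.symm a ≠ Finsupp.equivFunOnFinite.symm a + Finsupp.single j 1 := by
    intro h
    have := congrArg (fun d => d j) h
    simp only [Finsupp.coe_add, Pi.add_apply, Finsupp.single_eq_same] at this
    omega
  have key := PthPowerShift.stateWins_add_iff (K := ZMod 2) 2 1 (monomial (Finsupp.equivFunOnFinite.symm a) 1)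
    (monomial (Finsupp.equivFunOnFinite.symm a + Finsupp.single j 1) 1) ?_ ?_ r exc
  · rw [pow_one] at key
    exact key.mpr (stateWins_monomial a r exc)
  · intro d hd
    rw [support_monomial, if_neg one_ne_zero, Finset.mem_singleton] at hd
    subst hd
    rw [isPthPowerExponent_iff]
    intro i
    simp only [pow_one, Finsupp.coe_add, Pi.add_apply, Finsupp.coe_equivFunOnFinite_symm,
      Finsupp.single_apply]
    by_cases hij : j = i
    · rw [if_pos hij, ← hij]; omega
    · rw [if_neg hij, add_zero]; have := heven i (fun h => hij h.symm); omega
  · intro S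
    rw [ordAlong_monomial_add_monomial S hne one_ne_zero one_ne_zero, ordAlong_monomial S _ one_ne_zero,
      min_eq_left]
    have hle : degIn S (Finsupp.equivFunOnFinite.symm a) ≤
        degIn S (Finsupp.equivFunOnFinite.symm a + Finsupp.single j 1) := by
      unfold degIn
      exact Finset.sum_le_sum fun i _ => by
        rw [Finsupp.coe_add, Pi.add_apply]; exact Nat.le_add_right _ _
    exact_mod_cast hle

/-- The same with the leaf written as `x^a + x^{a + δ_j}`. [OURS · counted 0] [folklore] -/
theorem stateWins_monomial_add_monomial_odd_of_forall_even (j : Fin 4) (a : Fin 4 → ℕ) (hodd : a j % 2 = 1)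
    (heven : ∀ k, k ≠ j → a k % 2 = 0) (r : Fin 4 →₀ ℕ) (exc : Finset (Fin 4)) :
    StateWins 2 (⟨monomial (Finsupp.equivFunOnFinite.symm a) 1 +
      monomial (Finsupp.equivFunOnFinite.symm a + Finsupp.single j 1) 1, r, exc⟩ : State (ZMod 2)) := by
  have h := stateWins_unitLeaf_odd_of_forall_even j a hodd heven r exc
  rwa [mul_add, mul_one, X, monomial_mul, one_mul] at h

end PureLeafNF

end Summit.ResolutionOfSingularities.ResolutionOfSingularities.Theorems.PIDim4

end
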